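import Mathlib
import HarnessLib
import Summits.HubbardSuperconductivity.HubbardSuperconductivity.Theorems.KLProgrammeC4aLevelDensityRadialValue
import Summits.HubbardSuperconductivity.HubbardSuperconductivity.Theorems.KLProgrammeC4aJacSymbol

/-!
# Route `KLProgramme` — crux C4a, value layer (k = 0): the co-moving chart's RADIAL DISPLACEMENT and the tube-tadpole VALUE for a general
# `C¹`-bounded vertex — the `Λ_n²` law with explicit constants `(M, G₁)`

Cell `gate-hubbard-kl`, lane hubbard-kl-k3c3-p3 (g10, Jacobian-certificate lineage); helper for the engine-flow child `KLRegimeEngineV17F2`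
(stmt-HubbardSuperconductivity-20437), stub (C) `stub_twoLeg_curvature`, k = 0 VALUE clause (located risk #12 «(C)-VALUE-K0»; the (L3-val) interface of
`…C4aTubeTadpoleValue` / C4A-PLAN §17.3).  Third file of the radial-row bundle (`…C4aLevelDensityRadial` p573650 — the Jacobian row `jacR`;
`…C4aLevelDensityRadialValue` — the Hartree value and the dominator modulo the vertex's odd-difference `e`).  Here the vertex half is reduced to SIZES:
* §1 `levelPoint_sub_levelPoint`, `norm_levelPoint_sub_levelPoint`, **`norm_levelPoint_sub_levelPoint_le`**: two chart points on one ray differ by the radii,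
  `‖Φ(ρ,ϑ) − Φ(ρ',ϑ)‖ = |u_K(μ+ρ;ϑ) − u_K(μ+ρ';ϑ)| ≤ |ρ − ρ'|/(Dt_min − 2A)` (level-Lipschitz of the radius, k3c2-p2's `klrf_level_lipschitz`);
* §2 **`norm_vertex_levelPoint_sub_le`**: a vertex `q ↦ V(k, q)` differentiable with `‖D_qV‖ ≤ G₁` moves by at most `G₁·|ρ − ρ'|/(Dt_min − 2A)` between them;
* §3 **`norm_tubeAngularAvg_sub_neg_le_of_sizes`**: for a jointly smooth vertex with `‖V(Φ(0,θ), ·)‖ ≤ M` on the tube and `‖D_qV(Φ(0,θ), ·)‖ ≤ G₁`, the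
  (L3-val) dominator is LINEAR: `‖G_θ(ρ) − G_θ(−ρ)‖ ≤ (4π·jacR·M + 4π²√2·G₁/(Dt_min − 2A)²)·|ρ|`, `jacR = 1/(Dt_min−2A)² + π√2(2+4A)/(Dt_min−2A)³`;
* §4 **`norm_tubeTadpole_le_of_sizes`**: hence for an odd level profile `f` supported in `(−r, r)` the momentum-space tube tadpole obeys
  `‖T(θ)‖ ≤ (2π·jacR·M + 2π²√2·G₁/(Dt_min − 2A)²)·∫_{(−r,r)} ‖f(ρ)‖·|ρ| dρ` — the first radial MOMENT of the slice (`≍ Λ_n²`), i.e. the k = 0 slot's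
  `16^{−n}` law for ANY vertex with scale-free sizes `(M, G₁)`; the fat vertex's finer odd-difference structure (§17.3: near-field evenness, far-field
  principal value) enters only if `G₁` is not n-free, through the `e`-form of `…RadialValue.norm_tubeAngularAvg_sub_le`.
Pure calculus on the tree's objects; nothing is asserted about the Hubbard model.  References: BGM 2006 §2.4 Lemma 2.1 [cite: BenfattoGiulianiMastropietro2006].
-/

noncomputable section

namespace Summit.HubbardSuperconductivity.HubbardSuperconductivity.Theorems.C4a

set_option linter.dupNamespace false -- summit = problem name (single-conjunct summit), D-0017

open Real Set MeasureTheory Filter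
open scoped ContDiff Topology
open Literature.MathematicalPhysics.QuantumLattice Literature.MathematicalPhysics.QuantumLattice.BandSectorCounting
open Summit.HubbardSuperconductivity.HubbardSuperconductivity.Theorems.DispersionFlow
open Summit.HubbardSuperconductivity.HubbardSuperconductivity.Theorems.KLRegimeSplit
open Summit.HubbardSuperconductivity.HubbardSuperconductivity.Theorems.PerturbedFermiCurve

/-! ## §1 Radial displacement of the chart -/

/-- Two chart points on one ray differ by the scaled direction: `Φ(ρ,ϑ) − Φ(ρ',ϑ) = toLp ((u − u') • dir ϑ)`. -/
theorem levelPoint_sub_levelPoint (μ : ℝ) (K : TrigPolyC4v) (ρ ρ' ϑ : ℝ) :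
    levelPoint μ K ρ ϑ - levelPoint μ K ρ' ϑ =
      WithLp.toLp 2 ((perturbedFermiRadius (fun k : Fin 2 → ℝ => -K.eval k) (μ + ρ) ϑ -
        perturbedFermiRadius (fun k : Fin 2 → ℝ => -K.eval k) (μ + ρ') ϑ) • dir ϑ) := by
  rw [levelPoint_eq_toLp_smul_dir, levelPoint_eq_toLp_smul_dir, ← WithLp.toLp_sub, sub_smul]

/-- `‖Φ(ρ,ϑ) − Φ(ρ',ϑ)‖ = |u_K(μ+ρ;ϑ) − u_K(μ+ρ';ϑ)|`. -/
theorem norm_levelPoint_sub_levelPoint (μ : ℝ) (K : TrigPolyC4v) (ρ ρ' ϑ : ℝ) :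
    ‖levelPoint μ K ρ ϑ - levelPoint μ K ρ' ϑ‖ =
      |perturbedFermiRadius (fun k : Fin 2 → ℝ => -K.eval k) (μ + ρ) ϑ -
        perturbedFermiRadius (fun k : Fin 2 → ℝ => -K.eval k) (μ + ρ') ϑ| := by
  rw [levelPoint_sub_levelPoint, norm_toLp_smul_dir]

section Sizes

variable {a b : ℝ} (B : BandBounds a b) {K : TrigPolyC4v} {A : ℝ}
  (hA : ∀ p : Momentum, ∀ j ≤ 2, ‖iteratedFDeriv ℝ j (frameShift K) p‖ ≤ A) (hADt : 2 * A < B.Dtmin)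
  {μ r : ℝ} (hlo : a < μ - r - A) (hhi : μ + r + A < b)
include B hA hADt hlo hhi

/-- **Radial displacement of the chart**: for `ρ, ρ' ∈ (−r, r)`, `‖Φ(ρ,ϑ) − Φ(ρ',ϑ)‖ ≤ |ρ − ρ'|/(Dt_min − 2A)` (the radius is
`1/(Dt_min − 2A)`-Lipschitz in the level, `klrf_level_lipschitz` at `κ₀ = A`, `κ₁ = 2A`). -/
theorem norm_levelPoint_sub_levelPoint_le {ρ ρ' : ℝ} (hρ : ρ ∈ Ioo (-r) r) (hρ' : ρ' ∈ Ioo (-r) r) (ϑ : ℝ) :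
    ‖levelPoint μ K ρ ϑ - levelPoint μ K ρ' ϑ‖ ≤ |ρ - ρ'| / (B.Dtmin - 2 * A) := by
  have hC : ContDiff ℝ 1 (fun k : Fin 2 → ℝ => -K.eval k) := by
    rw [← frameShift_toLp_eq_neg_eval]; exact contDiff_frameShift_toLp K
  have hδ : ∀ k : Fin 2 → ℝ, (∀ i, |k i| ≤ π) → |(fun q : Fin 2 → ℝ => -K.eval q) k| ≤ A := fun k _ => by
    simpa [frameShift_toLp] using abs_frameShift_toLp_le hA k
  have hκ : ∀ k : Fin 2 → ℝ, (∀ i, |k i| ≤ π) → ‖fderiv ℝ (fun q : Fin 2 → ℝ => -K.eval q) k‖ ≤ 2 * A := fun k _ => by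
    rw [← frameShift_toLp_eq_neg_eval]; exact norm_fderiv_frameShift_toLp_le hA k
  have h1 : a ≤ μ + ρ - A := by have := hρ.1; linarith
  have h2 : μ + ρ + A ≤ b := by have := hρ.2; linarith
  have h1' : a ≤ μ + ρ' - A := by have := hρ'.1; linarith
  have h2' : μ + ρ' + A ≤ b := by have := hρ'.2; linarith
  rw [norm_levelPoint_sub_levelPoint]
  have h := klrf_level_lipschitz B hC hδ hκ hADt h1' h2' h1 h2 ϑ
  simpa [add_sub_add_left_eq_sub] using h

/-! ## §2 A `C¹`-bounded vertex along the ray -/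

omit B hA hADt hlo hhi in
/-- **Mean value for the vertex in momentum space**: if `q ↦ W q` is differentiable with `‖DW(q)‖ ≤ G₁` everywhere, then
`‖W q − W q'‖ ≤ G₁·‖q − q'‖`. -/
theorem norm_apply_sub_le_of_fderiv_le {W : Momentum → ℂ} (hW : Differentiable ℝ W) {G₁ : ℝ} (hG : ∀ q, ‖fderiv ℝ W q‖ ≤ G₁)
    (q q' : Momentum) : ‖W q - W q'‖ ≤ G₁ * ‖q - q'‖ :=
  Convex.norm_image_sub_le_of_norm_fderiv_le (fun x _ => hW x) (fun x _ => hG x) convex_univ (mem_univ q') (mem_univ q)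

/-- **The vertex moves by at most `G₁·|ρ − ρ'|/(Dt_min − 2A)` between two chart points of one ray.** -/
theorem norm_vertex_levelPoint_sub_le {W : Momentum → ℂ} (hW : Differentiable ℝ W) {G₁ : ℝ} (hG : ∀ q, ‖fderiv ℝ W q‖ ≤ G₁)
    {ρ ρ' : ℝ} (hρ : ρ ∈ Ioo (-r) r) (hρ' : ρ' ∈ Ioo (-r) r) (ϑ : ℝ) :
    ‖W (levelPoint μ K ρ ϑ) - W (levelPoint μ K ρ' ϑ)‖ ≤ G₁ * (|ρ - ρ'| / (B.Dtmin - 2 * A)) := by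
  have hG0 : 0 ≤ G₁ := (norm_nonneg _).trans (hG 0)
  exact (norm_apply_sub_le_of_fderiv_le hW hG _ _).trans
    (mul_le_mul_of_nonneg_left (norm_levelPoint_sub_levelPoint_le B hA hADt hlo hhi hρ hρ' ϑ) hG0)

/-! ## §3 The (L3-val) dominator from the sizes `(M, G₁)` -/

/-- **(L3-val) from sizes**: for a jointly smooth vertex `V` read from `Φ(0,θ)` with `‖V(Φ(0,θ), Φ(ρ,ϑ))‖ ≤ M` at the level `ρ` and
`‖D_qV(Φ(0,θ), q)‖ ≤ G₁` for all `q`, the odd-difference of the angular average is LINEAR in the level: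
`‖G_θ(ρ) − G_θ(−ρ)‖ ≤ (4π·jacR·M + 4π²√2·G₁/(Dt_min − 2A)²)·|ρ|`. -/
theorem norm_tubeAngularAvg_sub_neg_le_of_sizes {V : Momentum → Momentum → ℂ}
    (hV : ContDiff ℝ ∞ fun x : Momentum × Momentum => V x.1 x.2) (θ : ℝ) {ρ : ℝ} (hρ : ρ ∈ Ioo (-r) r) {M G₁ : ℝ}
    (hM : ∀ ϑ ∈ Ioc 0 (2 * π), ‖V (levelPoint μ K 0 θ) (levelPoint μ K ρ ϑ)‖ ≤ M)
    (hG : ∀ q : Momentum, ‖fderiv ℝ (V (levelPoint μ K 0 θ)) q‖ ≤ G₁) :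
    ‖tubeAngularAvg μ K V θ ρ - tubeAngularAvg μ K V θ (-ρ)‖ ≤
      (4 * π * (1 / (B.Dtmin - 2 * A) ^ 2 + Real.pi * Real.sqrt 2 * (2 + 4 * A) / (B.Dtmin - 2 * A) ^ 3) * M +
        4 * π ^ 2 * Real.sqrt 2 * G₁ / (B.Dtmin - 2 * A) ^ 2) * |ρ| := by
  have hρ' : -ρ ∈ Ioo (-r) r := ⟨by linarith [hρ.2], by linarith [hρ.1]⟩
  have hd : 0 < B.Dtmin - 2 * A := by linarith
  -- the vertex at fixed first argument is differentiable (joint smoothness composed with `q ↦ (k, q)`)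
  have hW : Differentiable ℝ (V (levelPoint μ K 0 θ)) := by
    have h1 : ContDiff ℝ ∞ ((fun x : Momentum × Momentum => V x.1 x.2) ∘ fun q : Momentum => (levelPoint μ K 0 θ, q)) :=
      hV.comp (contDiff_const.prodMk contDiff_id)
    simpa [Function.comp_def] using h1.differentiable (by simp)
  -- the vertex's own odd-difference along the chart: constant dominator `e = G₁·2|ρ|/(Dt−2A)`
  have he : ∀ ϑ ∈ Ioc 0 (2 * π), ‖V (levelPoint μ K 0 θ) (levelPoint μ K ρ ϑ) - V (levelPoint μ K 0 θ) (levelPoint μ K (-ρ) ϑ)‖ ≤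
      G₁ * (2 * |ρ| / (B.Dtmin - 2 * A)) := by
    intro ϑ _
    have h := norm_vertex_levelPoint_sub_le B hA hADt hlo hhi hW hG hρ hρ' ϑ
    have h2 : |ρ - -ρ| = 2 * |ρ| := by rw [sub_neg_eq_add, ← two_mul, abs_mul, abs_two]
    rwa [h2] at h
  have hvol : volume (Ioc 0 (2 * π)) < ⊤ := by rw [Real.volume_Ioc]; exact ENNReal.ofReal_lt_top
  have h := norm_tubeAngularAvg_sub_neg_le B hA hADt hlo hhi hV θ hρ hM he (integrableOn_const hvol.ne)
  refine h.trans (le_of_eq ?_)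
  rw [setIntegral_const, Real.volume_real_Ioc_of_le (by positivity), smul_eq_mul]
  have hd' : B.Dtmin - 2 * A ≠ 0 := hd.ne'
  field_simp
  ring

/-! ## §4 The tube tadpole value for a `C¹`-bounded vertex: the `Λ_n²` law -/

/-- **THE TUBE TADPOLE VALUE FROM VERTEX SIZES.**  For an odd level profile `f` supported in `(−r, r)` and a jointly smooth vertex `V` with
`‖V(Φ(0,θ), Φ(ρ,ϑ))‖ ≤ M` on the tube and `‖D_qV(Φ(0,θ), ·)‖ ≤ G₁`, the momentum-space one-slice tadpole read at the curve point `Φ(0,θ)` obeys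
`‖T(θ)‖ ≤ (2π·jacR·M + 2π²√2·G₁/(Dt_min − 2A)²)·∫_{(−r,r)} ‖f(ρ)‖·|ρ| dρ`
— the first radial moment of the slice (`≍ Λ_n²`): the k = 0 slot's `16^{−n}` law for any vertex with n-free sizes `(M, G₁)`
(`norm_tubeTadpole_le_of_odd` ∘ §3). -/
theorem norm_tubeTadpole_le_of_sizes {f : ℝ → ℂ} (hf : ContDiff ℝ ∞ f) (hfsupp : tsupport f ⊆ Ioo (-r) r)
    (hodd : ∀ ρ, f (-ρ) = -f ρ) {V : Momentum → Momentum → ℂ} (hV : ContDiff ℝ ∞ fun x : Momentum × Momentum => V x.1 x.2)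
    (θ : ℝ) {M G₁ : ℝ} (hM : ∀ ρ ∈ Ioo (-r) r, ∀ ϑ : ℝ, ‖V (levelPoint μ K 0 θ) (levelPoint μ K ρ ϑ)‖ ≤ M)
    (hG : ∀ q : Momentum, ‖fderiv ℝ (V (levelPoint μ K 0 θ)) q‖ ≤ G₁) :
    ‖∫ q in {q : ℝ × ℝ | |q.1| < π ∧ |q.2| < π ∧ |frameLevel μ K (WithLp.toLp 2 ![q.1, q.2])| < r},
        f (frameLevel μ K (WithLp.toLp 2 ![q.1, q.2])) * V (levelPoint μ K 0 θ) (WithLp.toLp 2 ![q.1, q.2])‖ ≤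
      (2 * π * (1 / (B.Dtmin - 2 * A) ^ 2 + Real.pi * Real.sqrt 2 * (2 + 4 * A) / (B.Dtmin - 2 * A) ^ 3) * M +
          2 * π ^ 2 * Real.sqrt 2 * G₁ / (B.Dtmin - 2 * A) ^ 2) *
        ∫ ρ in Ioo (-r) r, ‖f ρ‖ * |ρ| := by
  set D := 4 * π * (1 / (B.Dtmin - 2 * A) ^ 2 + Real.pi * Real.sqrt 2 * (2 + 4 * A) / (B.Dtmin - 2 * A) ^ 3) * M +
    4 * π ^ 2 * Real.sqrt 2 * G₁ / (B.Dtmin - 2 * A) ^ 2 with hDdef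
  have hd : ∀ ρ ∈ Ioo (-r) r, ‖tubeAngularAvg μ K V θ ρ - tubeAngularAvg μ K V θ (-ρ)‖ ≤ D * |ρ| := fun ρ hρ =>
    norm_tubeAngularAvg_sub_neg_le_of_sizes B hA hADt hlo hhi hV θ hρ (fun ϑ _ => hM ρ hρ ϑ) hG
  have h := norm_tubeTadpole_le_of_odd B hA hADt hlo hhi hf hfsupp hodd hV θ (d := fun ρ => D * |ρ|) hd
    ((integrableOn_norm_mul_const_mul_abs hf.continuous D).congr (Filter.Eventually.of_forall fun ρ => by simp only))
  refine h.trans (le_of_eq ?_)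
  have hI : (∫ ρ in Ioo (-r) r, ‖f ρ‖ * (D * |ρ|)) = D * ∫ ρ in Ioo (-r) r, ‖f ρ‖ * |ρ| := by
    rw [← integral_const_mul]
    exact integral_congr_ae (Filter.Eventually.of_forall fun ρ => by simp only; ring)
  rw [hI, hDdef]
  ring

end Sizes

end Summit.HubbardSuperconductivity.HubbardSuperconductivity.Theorems.C4a

end
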